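import Literature.NumberTheory.Transcendental.AnalytificationHolomorphyTest
import Literature.Topology.Euclidean.InvarianceOfDimension
import Literature.Analysis.Complex.InjectiveHolomorphic
import HarnessLib

/-!
# A holomorphic local homeomorphism into an analytification is a local biholomorphism

Topic `Literature/NumberTheory/Transcendental`, namespace `Literature.NumberTheory.Transcendental`
(grouping sub-namespace `IsAnalytification`). THEOREMS ONLY.

This is the generic form of the statement «the uniformisation `𝔹 → Γ\𝔹 = X(ℂ)` (resp.
`𝔥_g → Γ_δ(N)\𝔥_g = S(ℂ)`) is a local biholomorphism onto the complex manifold `X^an`», as it is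
used for compact ball quotients ([BergeronMillsonMoeglin2016Balls] Introduction §1.1: «`S(Γ) = Γ\X`
is a complex manifold» for torsion-free `Γ`) and for the Siegel modular variety ([GenestierNgo2020]
Prop. 1.3.2: «For `N ≥ 3` … acts freely on the Siegel half-space … The quotient is therefore a
smooth complex analytic space»).  The tree records uniformisations EXTRINSICALLY
(`ShimuraVarieties.UnitaryBallUniformisationDatum`, `ModuliOfAbelianVarieties.SiegelModuliDatum`):
a map `u` from an open set `O` of a complex vector space `G` to the complex points `Y(ℂ)` of a
smooth variety which is continuous, open, with prescribed fibres, and «holomorphic in algebraic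
coordinates» (regular functions pull back to holomorphic functions).  Given ANY analytification
`ψ : M' → Y(ℂ)` with a holomorphic atlas (`IsAnalytification E' Y m ψ`), we prove, for such `u`
with `O.restrict u` a local homeomorphism:

* `IsAnalytification.mdifferentiableAt_symm_comp` — the lift `ũ = ψ⁻¹ ∘ u : O → M'` is
  holomorphic (holomorphy into `Y^an` is tested on regular functions,
  `IsAnalytification.mdifferentiableAt_of_comp_regular`; Serre, GAGA §2 n°6 Prop. 3 Cor. 2);
* `IsAnalytification.finrank_eq_of_isLocalHomeomorph_restrict` — `dim_ℂ G = m`: a local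
  homeomorphism between an open set of `G` and the `m`-dimensional manifold `M'` forces equal
  dimensions (Brouwer's invariance of dimension,
  `Literature.Topology.Euclidean.Brouwer.finrank_complex_le_of_injOn_of_isOpen`);
* `IsAnalytification.bijective_mfderiv_symm_comp` — the differential of `ũ` at every point of
  `O` is bijective: in a chart, `ũ` is an injective holomorphic map between open sets of
  `ℂ`-vector spaces of the same dimension, so Clements–Osgood
  (`Literature.Analysis.Complex.SCV.bijective_fderiv_of_injOn`, [FritzscheGrauert2002] Ch. I §8
  Thm. 8.5) applies;
* `IsAnalytification.injective_mfderiv_symm_comp` / `…surjective…` — the two halves.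

Consumers: `stub_S2imm` of the I-1′ receptacle line (cell hodgecm-mathlib): local biholomorphy of
the ball uniformisation of `Sh_K(U(V))` and of the Siegel uniformisation `𝔥_g → A_{g,δ,N}(ℂ)`,
through which the analytic differential of an algebraic map is computed.

## References

* [SerreGAGA1956] J.-P. Serre, *GAGA*, Ann. Inst. Fourier 6 (1956), §2 n°5–6.
* [FritzscheGrauert2002] K. Fritzsche, H. Grauert, *From Holomorphic Functions to Complex
  Manifolds* (2002), Ch. I §8 Thm. 8.5, Cor. 8.6; Ch. IV §1.
* [Brouwer1911Dimension] L. E. J. Brouwer, *Beweis der Invarianz der Dimensionenzahl*, Math. Ann.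
  70 (1911), 161–165.
* [GenestierNgo2020] A. Genestier, B. C. Ngô, *Lectures on Shimura varieties*, Prop. 1.3.2.
-/

noncomputable section

open Set Function Filter TopologicalSpace CategoryTheory AlgebraicGeometry
open scoped Manifold ContDiff Topology

namespace Literature.NumberTheory.Transcendental

open Literature.AlgebraicGeometry.Motives (ComplexPoints AlgPoints SchemeOver)
open Literature.AlgebraicGeometry.Motives.AlgPoints

namespace IsAnalytification

variable {E' : Type*} [NormedAddCommGroup E'] [NormedSpace ℂ E'] [FiniteDimensional ℂ E']
  {M' : Type*} [TopologicalSpace M'] [ChartedSpace E' M']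
  {G : Type*} [NormedAddCommGroup G] [NormedSpace ℂ G]
  {k : Type} [Field k] [Algebra k ℂ] {Y : SchemeOver k} {m : ℕ} {ψ : M' → ComplexPoints Y}

/-- **The lift `ψ⁻¹ ∘ u` of a map holomorphic in algebraic coordinates is holomorphic.**  Let
`ψ : M' → Y(ℂ)` be an analytification with holomorphic atlas of the smooth `k`-scheme `Y` of
relative dimension `m`, `O ⊆ G` an open set of a complex normed space and `u : G → Y(ℂ)` continuous
on `O` such that every regular function `s ∈ Γ(Y, U)` on an affine open `U`, read through `u`,
is holomorphic on `O ∩ u⁻¹(U(ℂ))`.  Then `ψ⁻¹ ∘ u` is holomorphic at every point of `O` (Serre: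
holomorphy into `Y^h` is read on regular functions).
[cite: SerreGAGA1956, §2 n°6 Prop. 3 Cor. 2] -/
theorem mdifferentiableAt_symm_comp [SmoothOfRelativeDimension m Y.hom]
    [IsManifold 𝓘(ℂ, E') ω M'] (hψ : IsAnalytification E' Y m ψ) {u : G → ComplexPoints Y}
    {O : Set G} (hO : IsOpen O) (hcont : ContinuousOn u O)
    (hhol : ∀ (U : Y.left.affineOpens) (s : Y.left.presheaf.obj (Opposite.op (↑U : Y.left.Opens))),
      DifferentiableOn ℂ (fun z ↦ evalOrZero (↑U : Y.left.Opens) s (u z))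
        (O ∩ u ⁻¹' {P | P.pt ∈ (↑U : Y.left.Opens)}))
    {z : G} (hz : z ∈ O) :
    MDifferentiableAt 𝓘(ℂ, G) 𝓘(ℂ, E') (hψ.homeomorph.symm ∘ u) z := by
  have hcz : ContinuousAt (hψ.homeomorph.symm ∘ u) z :=
    hψ.homeomorph.symm.continuous.continuousAt.comp (hcont.continuousAt (hO.mem_nhds hz))
  refine mdifferentiableAt_of_comp_regular (E₀ := G) (N := G) hψ hcz fun V hV hzV s ↦ ?_
  have hψψ : ∀ w, ψ (hψ.homeomorph.symm (u w)) = u w := fun w ↦ by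
    simpa only [hψ.coe_homeomorph] using hψ.homeomorph.apply_symm_apply (u w)
  have hfun : (fun w ↦ evalOrZero V s (ψ ((hψ.homeomorph.symm ∘ u) w))) =
      fun w ↦ evalOrZero V s (u w) := by
    funext w; simp only [Function.comp_apply, hψψ]
  rw [hfun]
  have hopen : IsOpen (O ∩ u ⁻¹' {P : ComplexPoints Y | P.pt ∈ V}) :=
    hcont.isOpen_inter_preimage hO (isOpen_setOf_pt_mem V)
  have hzmem : z ∈ O ∩ u ⁻¹' {P : ComplexPoints Y | P.pt ∈ V} := by
    refine ⟨hz, ?_⟩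
    show (u z).pt ∈ V
    have : (ψ ((hψ.homeomorph.symm ∘ u) z)).pt ∈ V := hzV
    rwa [Function.comp_apply, hψψ] at this
  exact mdifferentiableAt_iff_differentiableAt.2
    ((hhol ⟨V, hV⟩ s).differentiableAt (hopen.mem_nhds hzmem))

/-- **Invariance of dimension for uniformisations.**  If `O ⊆ G` is open and non-empty and
`u : G → Y(ℂ)` restricts on `O` to a local homeomorphism into the complex points of `Y`, and
`ψ : M' → Y(ℂ)` is an analytification of `Y` of relative dimension `m`, then `dim_ℂ G = m`:
composing with `ψ⁻¹` and a chart of `M'` gives continuous injections between non-empty open subsets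
of `G` and of the model space `E'` (`dim_ℂ E' = m`) in both directions, and Brouwer's invariance of
dimension applies. [cite: Brouwer1911Dimension, Satz 1 (p. 161)] -/
theorem finrank_eq_of_isLocalHomeomorph_restrict [FiniteDimensional ℂ G]
    (hψ : IsAnalytification E' Y m ψ) {u : G → ComplexPoints Y} {O : Set G} (hO : IsOpen O)
    (hne : O.Nonempty) (hloc : IsLocalHomeomorph (O.restrict u)) :
    Module.finrank ℂ G = m := by
  classical
  obtain ⟨z, hz⟩ := hne
  obtain ⟨e, hze, he⟩ := hloc ⟨z, hz⟩
  set Ψ := hψ.homeomorph with hΨ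
  set x : M' := Ψ.symm (u z) with hx
  set χ : OpenPartialHomeomorph M' E' := chartAt E' x with hχ
  rw [← hψ.finrank_eq]
  refine le_antisymm ?_ ?_
  · -- `χ ∘ ψ⁻¹ ∘ u` is a continuous injection on an open neighbourhood of `z`
    set V₀ : Set G := Subtype.val '' e.source with hV₀
    have hV₀o : IsOpen V₀ := hO.isOpenMap_subtype_val _ e.open_source
    have hV₀O : V₀ ⊆ O := Subtype.coe_image_subset O e.source
    have huinj : InjOn u V₀ := by
      rintro _ ⟨a, ha, rfl⟩ _ ⟨b, hb, rfl⟩ hab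
      have : e a = e b := by
        rw [← he]; exact hab
      rw [e.injOn ha hb this]
    have hcontO : ContinuousOn u O := by
      rw [continuousOn_iff_continuous_restrict]; exact hloc.continuous
    set W : Set (ComplexPoints Y) := Ψ.symm ⁻¹' χ.source with hW
    have hWo : IsOpen W := Ψ.symm.continuous.isOpen_preimage _ χ.open_source
    set O₁ : Set G := V₀ ∩ u ⁻¹' W with hO₁
    have hO₁o : IsOpen O₁ := (hcontO.mono hV₀O).isOpen_inter_preimage hV₀o hWo
    have hzO₁ : z ∈ O₁ := ⟨⟨⟨z, hz⟩, hze, rfl⟩, by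
      show Ψ.symm (u z) ∈ χ.source
      exact mem_chart_source E' x⟩
    refine Literature.Topology.Euclidean.Brouwer.finrank_complex_le_of_injOn_of_isOpen
      (f := fun w ↦ χ (Ψ.symm (u w))) hO₁o ⟨z, hzO₁⟩ ?_ ?_
    · refine χ.continuousOn.comp (Ψ.symm.continuous.comp_continuousOn
        (hcontO.mono (inter_subset_left.trans hV₀O))) fun w hw ↦ hw.2
    · intro a ha b hb hab
      exact huinj ha.1 hb.1 (Ψ.symm.injective (χ.injOn ha.2 hb.2 hab))
  · -- `ψ ∘ χ⁻¹` followed by the local inverse of `u` is a continuous injection on an open set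
    set O₂ : Set E' := χ.target ∩ χ.symm ⁻¹' (Ψ ⁻¹' e.target) with hO₂
    have hO₂o : IsOpen O₂ :=
      χ.isOpen_inter_preimage_symm (Ψ.continuous.isOpen_preimage _ e.open_target)
    have huz : u z = e ⟨z, hz⟩ := by
      have := congrFun he ⟨z, hz⟩; simpa only [restrict_apply] using this
    have hxO₂ : χ x ∈ O₂ := by
      refine ⟨χ.map_source (mem_chart_source E' x), ?_⟩
      show Ψ (χ.symm (χ x)) ∈ e.target
      rw [χ.left_inv (mem_chart_source E' x), hx, Ψ.apply_symm_apply, huz]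
      exact e.map_source hze
    refine Literature.Topology.Euclidean.Brouwer.finrank_complex_le_of_injOn_of_isOpen
      (f := fun y ↦ ((e.symm (Ψ (χ.symm y)) : O) : G)) hO₂o ⟨χ x, hxO₂⟩ ?_ ?_
    · have hc1 : ContinuousOn (fun y ↦ Ψ (χ.symm y)) O₂ :=
        Ψ.continuous.comp_continuousOn (χ.continuousOn_symm.mono inter_subset_left)
      have hmaps : MapsTo (fun y ↦ Ψ (χ.symm y)) O₂ e.target := fun y hy ↦ hy.2
      have hc2 : ContinuousOn (fun y ↦ e.symm (Ψ (χ.symm y))) O₂ :=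
        e.continuousOn_symm.comp hc1 hmaps
      exact continuous_subtype_val.comp_continuousOn hc2
    · intro a ha b hb hab
      have h1 : e.symm (Ψ (χ.symm a)) = e.symm (Ψ (χ.symm b)) := Subtype.ext hab
      have h2 : Ψ (χ.symm a) = Ψ (χ.symm b) := e.symm.injOn ha.2 hb.2 h1
      exact χ.symm.injOn ha.1 hb.1 (Ψ.injective h2)

/-- **A holomorphic local homeomorphism into an analytification is a local biholomorphism.**
Let `ψ : M' → Y(ℂ)` be an analytification with holomorphic atlas of the smooth `k`-scheme `Y` of
relative dimension `m`, `O ⊆ G` open in a finite-dimensional complex normed space, and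
`u : G → Y(ℂ)` such that `O.restrict u` is a local homeomorphism into `Y(ℂ)` and `u` is
holomorphic in algebraic coordinates on `O`.  Then the differential of the lift `ψ⁻¹ ∘ u` is
bijective at every point of `O`.  Proof: in the chart `χ` of `M'` at `ψ⁻¹(u z)`, the map
`χ ∘ ψ⁻¹ ∘ u` is holomorphic and injective on an open neighbourhood of `z`, between spaces of the
same dimension (`finrank_eq_of_isLocalHomeomorph_restrict`); by the Clements–Osgood theorem its
differential is bijective, and `dχ` is invertible. [cite: FritzscheGrauert2002, Ch. I §8 Thm. 8.5] -/
theorem bijective_mfderiv_symm_comp [FiniteDimensional ℂ G] [SmoothOfRelativeDimension m Y.hom]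
    [IsManifold 𝓘(ℂ, E') ω M'] (hψ : IsAnalytification E' Y m ψ) {u : G → ComplexPoints Y}
    {O : Set G} (hO : IsOpen O) (hloc : IsLocalHomeomorph (O.restrict u))
    (hhol : ∀ (U : Y.left.affineOpens) (s : Y.left.presheaf.obj (Opposite.op (↑U : Y.left.Opens))),
      DifferentiableOn ℂ (fun z ↦ evalOrZero (↑U : Y.left.Opens) s (u z))
        (O ∩ u ⁻¹' {P | P.pt ∈ (↑U : Y.left.Opens)}))
    {z : G} (hz : z ∈ O) :
    Function.Bijective (mfderiv 𝓘(ℂ, G) 𝓘(ℂ, E') (hψ.homeomorph.symm ∘ u) z) := by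
  classical
  haveI : IsManifold 𝓘(ℂ, E') 1 M' := inferInstance
  have hcontO : ContinuousOn u O := by
    rw [continuousOn_iff_continuous_restrict]; exact hloc.continuous
  set Ψ := hψ.homeomorph with hΨ
  set ut : G → M' := Ψ.symm ∘ u with hut
  set x : M' := ut z with hx
  -- local injectivity of `u` near `z`
  obtain ⟨e, hze, he⟩ := hloc ⟨z, hz⟩
  set V₀ : Set G := Subtype.val '' e.source with hV₀
  have hV₀o : IsOpen V₀ := hO.isOpenMap_subtype_val _ e.open_source
  have hV₀O : V₀ ⊆ O := Subtype.coe_image_subset O e.source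
  have huinj : InjOn u V₀ := by
    rintro _ ⟨a, ha, rfl⟩ _ ⟨b, hb, rfl⟩ hab
    have : e a = e b := by
      rw [← he]; exact hab
    rw [e.injOn ha hb this]
  -- the open set on which `Yf = χ ∘ ũ` is injective and holomorphic
  set O' : Set G := V₀ ∩ ut ⁻¹' (chartAt E' x).source with hO'
  have hutc : ContinuousOn ut O := Ψ.symm.continuous.comp_continuousOn hcontO
  have hO'o : IsOpen O' := (hutc.mono hV₀O).isOpen_inter_preimage hV₀o (chartAt E' x).open_source
  have hzO' : z ∈ O' := ⟨⟨⟨z, hz⟩, hze, rfl⟩, mem_chart_source E' x⟩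
  set Yf : G → E' := fun w ↦ extChartAt 𝓘(ℂ, E') x (ut w) with hYf
  have hmd : ∀ w ∈ O, MDifferentiableAt 𝓘(ℂ, G) 𝓘(ℂ, E') ut w :=
    fun w hw ↦ hψ.mdifferentiableAt_symm_comp hO hcontO hhol hw
  have hYd : DifferentiableOn ℂ Yf O' := by
    intro w hw
    have h1 := hmd w (hV₀O hw.1)
    have h2 : MDifferentiableAt 𝓘(ℂ, E') 𝓘(ℂ, E') (extChartAt 𝓘(ℂ, E') x) (ut w) :=
      mdifferentiableAt_extChartAt hw.2
    exact (mdifferentiableAt_iff_differentiableAt.1 (h2.comp w h1)).differentiableWithinAt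
  have hYinj : InjOn Yf O' := by
    intro a ha b hb hab
    have hsa : ut a ∈ (extChartAt 𝓘(ℂ, E') x).source := by rw [extChartAt_source]; exact ha.2
    have hsb : ut b ∈ (extChartAt 𝓘(ℂ, E') x).source := by rw [extChartAt_source]; exact hb.2
    have h1 : ut a = ut b := (extChartAt 𝓘(ℂ, E') x).injOn hsa hsb hab
    exact huinj ha.1 hb.1 (Ψ.symm.injective h1)
  -- equal dimensions, Clements–Osgood
  have hdim : Module.finrank ℂ G = Module.finrank ℂ E' := by
    rw [hψ.finrank_eq_of_isLocalHomeomorph_restrict hO ⟨z, hz⟩ hloc, hψ.finrank_eq]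
  have hbij : Function.Bijective (fderiv ℂ Yf z) :=
    Literature.Analysis.Complex.SCV.bijective_fderiv_of_injOn hdim hYd hO'o hYinj hzO'
  -- `dYf_z = dχ_x ∘ dũ_z` with `dχ_x` invertible
  have h1 : MDifferentiableAt 𝓘(ℂ, G) 𝓘(ℂ, E') ut z := hmd z hz
  have h2 : MDifferentiableAt 𝓘(ℂ, E') 𝓘(ℂ, E') (extChartAt 𝓘(ℂ, E') x) (ut z) :=
    mdifferentiableAt_extChartAt (mem_chart_source E' x)
  have hcomp : fderiv ℂ Yf z =
      (mfderiv 𝓘(ℂ, E') 𝓘(ℂ, E') (extChartAt 𝓘(ℂ, E') x) (ut z)).comp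
        (mfderiv 𝓘(ℂ, G) 𝓘(ℂ, E') ut z) := by
    rw [← mfderiv_eq_fderiv]
    exact mfderiv_comp z h2 h1
  have hinv := isInvertible_mfderiv_extChartAt (I := 𝓘(ℂ, E')) (x := x) (y := ut z)
    (by rw [extChartAt_source]; exact mem_chart_source E' x)
  obtain ⟨L, hL⟩ := hinv
  have hfun : ∀ v : G, mfderiv 𝓘(ℂ, G) 𝓘(ℂ, E') ut z v = L.symm (fderiv ℂ Yf z v) := by
    intro v
    have h : fderiv ℂ Yf z v =
        (mfderiv 𝓘(ℂ, E') 𝓘(ℂ, E') (extChartAt 𝓘(ℂ, E') x) (ut z))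
          (mfderiv 𝓘(ℂ, G) 𝓘(ℂ, E') ut z v) :=
      DFunLike.congr_fun hcomp v
    rw [← hL] at h
    rw [h]
    exact (L.symm_apply_apply _).symm
  refine ⟨fun (v : G) (w : G) hvw ↦ ?_, fun y ↦ ?_⟩
  · have hvw' : L.symm (fderiv ℂ Yf z v) = L.symm (fderiv ℂ Yf z w) := by
      rw [← hfun, ← hfun]; exact hvw
    exact hbij.1 (L.symm.injective hvw')
  · obtain ⟨v, hv⟩ := hbij.2 (L y)
    exact ⟨v, by rw [hfun, hv, ContinuousLinearEquiv.symm_apply_apply]⟩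

/-- The differential of the lift `ψ⁻¹ ∘ u` is injective at every point of `O` (half of
`bijective_mfderiv_symm_comp`). [cite: FritzscheGrauert2002, Ch. I §8 Thm. 8.5] -/
theorem injective_mfderiv_symm_comp [FiniteDimensional ℂ G] [SmoothOfRelativeDimension m Y.hom]
    [IsManifold 𝓘(ℂ, E') ω M'] (hψ : IsAnalytification E' Y m ψ) {u : G → ComplexPoints Y}
    {O : Set G} (hO : IsOpen O) (hloc : IsLocalHomeomorph (O.restrict u))
    (hhol : ∀ (U : Y.left.affineOpens) (s : Y.left.presheaf.obj (Opposite.op (↑U : Y.left.Opens))),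
      DifferentiableOn ℂ (fun z ↦ evalOrZero (↑U : Y.left.Opens) s (u z))
        (O ∩ u ⁻¹' {P | P.pt ∈ (↑U : Y.left.Opens)}))
    {z : G} (hz : z ∈ O) :
    Function.Injective (mfderiv 𝓘(ℂ, G) 𝓘(ℂ, E') (hψ.homeomorph.symm ∘ u) z) :=
  (hψ.bijective_mfderiv_symm_comp hO hloc hhol hz).1

/-- The differential of the lift `ψ⁻¹ ∘ u` is surjective at every point of `O` (half of
`bijective_mfderiv_symm_comp`). [cite: FritzscheGrauert2002, Ch. I §8 Thm. 8.5] -/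
theorem surjective_mfderiv_symm_comp [FiniteDimensional ℂ G] [SmoothOfRelativeDimension m Y.hom]
    [IsManifold 𝓘(ℂ, E') ω M'] (hψ : IsAnalytification E' Y m ψ) {u : G → ComplexPoints Y}
    {O : Set G} (hO : IsOpen O) (hloc : IsLocalHomeomorph (O.restrict u))
    (hhol : ∀ (U : Y.left.affineOpens) (s : Y.left.presheaf.obj (Opposite.op (↑U : Y.left.Opens))),
      DifferentiableOn ℂ (fun z ↦ evalOrZero (↑U : Y.left.Opens) s (u z))
        (O ∩ u ⁻¹' {P | P.pt ∈ (↑U : Y.left.Opens)}))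
    {z : G} (hz : z ∈ O) :
    Function.Surjective (mfderiv 𝓘(ℂ, G) 𝓘(ℂ, E') (hψ.homeomorph.symm ∘ u) z) :=
  (hψ.bijective_mfderiv_symm_comp hO hloc hhol hz).2

/-- **The lift is holomorphic at every point of `O`** under the local-homeomorphism hypothesis
(continuity on `O` is then automatic). [cite: SerreGAGA1956, §2 n°6 Prop. 3 Cor. 2] -/
theorem mdifferentiableAt_symm_comp_of_isLocalHomeomorph [SmoothOfRelativeDimension m Y.hom]
    [IsManifold 𝓘(ℂ, E') ω M'] (hψ : IsAnalytification E' Y m ψ) {u : G → ComplexPoints Y}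
    {O : Set G} (hO : IsOpen O) (hloc : IsLocalHomeomorph (O.restrict u))
    (hhol : ∀ (U : Y.left.affineOpens) (s : Y.left.presheaf.obj (Opposite.op (↑U : Y.left.Opens))),
      DifferentiableOn ℂ (fun z ↦ evalOrZero (↑U : Y.left.Opens) s (u z))
        (O ∩ u ⁻¹' {P | P.pt ∈ (↑U : Y.left.Opens)}))
    {z : G} (hz : z ∈ O) :
    MDifferentiableAt 𝓘(ℂ, G) 𝓘(ℂ, E') (hψ.homeomorph.symm ∘ u) z :=
  hψ.mdifferentiableAt_symm_comp hO
    (by rw [continuousOn_iff_continuous_restrict]; exact hloc.continuous) hhol hz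

end IsAnalytification

/-! ### Differentials through local parametrisations

How local biholomorphy is consumed: the differential of a map `f : M → M'` of complex manifolds at
`p` is injective as soon as, for some holomorphic local parametrisation `u_B` of `M` through `p`
with surjective differential (e.g. a local biholomorphism from `bijective_mfderiv_symm_comp`) and
some holomorphic `g` with injective differential, `f ∘ u_B = g` near the parameter point. -/

section LocalLift

variable {E : Type*} [NormedAddCommGroup E] [NormedSpace ℂ E]
  {M : Type*} [TopologicalSpace M] [ChartedSpace E M]
  {E' : Type*} [NormedAddCommGroup E'] [NormedSpace ℂ E']
  {M' : Type*} [TopologicalSpace M'] [ChartedSpace E' M']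
  {G : Type*} [NormedAddCommGroup G] [NormedSpace ℂ G]
  {G' : Type*} [NormedAddCommGroup G'] [NormedSpace ℂ G']

/-- **Immersion criterion through a local parametrisation.**  Let `f : M → M'` be differentiable
at `p = u_B z`, where `u_B : G → M` is differentiable at `z` with SURJECTIVE differential, and
suppose `f ∘ u_B` agrees near `z` with a map `g : G → M'` whose differential at `z` is injective.
Then the differential of `f` at `p` is injective (chain rule: `df_p ∘ d(u_B)_z = dg_z`).
[cite: FritzscheGrauert2002, Ch. IV §1 (holomorphic maps of complex manifolds, rank)] -/
theorem injective_mfderiv_of_eventuallyEq_comp {f : M → M'} {p : M} {uB : G → M} {g : G → M'}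
    {z : G} (hzp : uB z = p) (huB : MDifferentiableAt 𝓘(ℂ, G) 𝓘(ℂ, E) uB z)
    (hsurj : Function.Surjective (mfderiv 𝓘(ℂ, G) 𝓘(ℂ, E) uB z))
    (hf : MDifferentiableAt 𝓘(ℂ, E) 𝓘(ℂ, E') f p) (hcomm : f ∘ uB =ᶠ[𝓝 z] g)
    (hinj : Function.Injective (mfderiv 𝓘(ℂ, G) 𝓘(ℂ, E') g z)) :
    Function.Injective (mfderiv 𝓘(ℂ, E) 𝓘(ℂ, E') f p) := by
  subst hzp
  have hchain : mfderiv 𝓘(ℂ, G) 𝓘(ℂ, E') (f ∘ uB) z =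
      (mfderiv 𝓘(ℂ, E) 𝓘(ℂ, E') f (uB z)).comp (mfderiv 𝓘(ℂ, G) 𝓘(ℂ, E) uB z) :=
    mfderiv_comp z hf huB
  have heq : mfderiv 𝓘(ℂ, G) 𝓘(ℂ, E') (f ∘ uB) z = mfderiv 𝓘(ℂ, G) 𝓘(ℂ, E') g z :=
    hcomm.mfderiv_eq
  intro v w hvw
  obtain ⟨a, rfl⟩ := hsurj v
  obtain ⟨b, rfl⟩ := hsurj w
  have key : ∀ c : G, mfderiv 𝓘(ℂ, G) 𝓘(ℂ, E') g z c =
      mfderiv 𝓘(ℂ, E) 𝓘(ℂ, E') f (uB z) (mfderiv 𝓘(ℂ, G) 𝓘(ℂ, E) uB z c) := fun c ↦ by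
    have := DFunLike.congr_fun (heq.symm.trans hchain) c
    exact this
  have hab : mfderiv 𝓘(ℂ, G) 𝓘(ℂ, E') g z a = mfderiv 𝓘(ℂ, G) 𝓘(ℂ, E') g z b := by
    rw [key, key]; exact hvw
  rw [hinj hab]

/-- **Injective differential of a composite `u_S ∘ P`** with `P` a map of vector spaces: if
`dP_z` and `d(u_S)_{P z}` are injective, so is `d(u_S ∘ P)_z` (the form in which a period map
`P` into a uniformised target enters `injective_mfderiv_of_eventuallyEq_comp`).
[cite: FritzscheGrauert2002, Ch. IV §1 (holomorphic maps of complex manifolds, rank)] -/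
theorem injective_mfderiv_comp_of_injective {uS : G' → M'} {P : G → G'} {z : G}
    (huS : MDifferentiableAt 𝓘(ℂ, G') 𝓘(ℂ, E') uS (P z)) (hP : DifferentiableAt ℂ P z)
    (hinjS : Function.Injective (mfderiv 𝓘(ℂ, G') 𝓘(ℂ, E') uS (P z)))
    (hinjP : Function.Injective (fderiv ℂ P z)) :
    Function.Injective (mfderiv 𝓘(ℂ, G) 𝓘(ℂ, E') (uS ∘ P) z) := by
  have hPm : MDifferentiableAt 𝓘(ℂ, G) 𝓘(ℂ, G') P z := mdifferentiableAt_iff_differentiableAt.2 hP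
  have hchain := mfderiv_comp z huS hPm
  have hPd : mfderiv 𝓘(ℂ, G) 𝓘(ℂ, G') P z = fderiv ℂ P z := mfderiv_eq_fderiv
  intro v w hvw
  have key : ∀ c : G, mfderiv 𝓘(ℂ, G) 𝓘(ℂ, E') (uS ∘ P) z c =
      mfderiv 𝓘(ℂ, G') 𝓘(ℂ, E') uS (P z) (fderiv ℂ P z c) := fun c ↦ by
    have := DFunLike.congr_fun hchain c
    rw [hPd] at this
    exact this
  rw [key, key] at hvw
  exact hinjP (hinjS hvw)

end LocalLift

end Literature.NumberTheory.Transcendental
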